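import Summits.AtomisticToContinuum.FouriersLaw.Theses.CageBudgetFekete
import Literature.MathematicalPhysics.KineticTheory.InfiniteChainObservables
import Literature.MathematicalPhysics.KineticTheory.InfiniteChainGibbsExistenceShift
import Literature.MathematicalPhysics.KineticTheory.InfiniteChainShiftInvariantUniqueness
import Literature.MathematicalPhysics.KineticTheory.InfiniteChainSuperstableReversal
import Literature.MathematicalPhysics.KineticTheory.InfiniteChainPartialMomentumReversal
import Summits.AtomisticToContinuum.FouriersLaw.Theorems.EmbeddedDrudeMourreGreenKuboContinuationBmFlowInvariant
import Summits.AtomisticToContinuum.FouriersLaw.Theorems.EmbeddedDrudeMourreGreenKuboContinuationCurrentVariancePos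

/-!
# `HeatVarianceCalculus` / Negative: the carrier clause of `PreservesMeasure` is load-bearing

Support file (`--supports stmt-AtomisticToContinuum-15772`) of the disprover seat of the crux
`CageBudgetFekete.HeatVarianceCalculus` (route CageBudgetFekete of `AtomisticToContinuum/FouriersLaw`).
The crux is NOT refuted — it is proof-complete (line `canonical-rigidity`; stubs landed as
`…Theorems/CageBudgetFeketeHeatVarianceCalculusLaplace.lean` and
`…Theorems/CageBudgetFeketeHeatVarianceCalculusCanonicalMajorant.lean`). What is landed here is the
LOAD-BEARING ANALYSIS of its guard on the dynamics, importable by the planners of the three sibling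
cruxes of the route (`QuasiSuperadditiveHeatVariance`, `HeatVarianceCeiling`, `UnboundedHeatVariance`
quantify over the same guarded pairs `(μ_T, D)` verbatim):

* `static_sum_pos` — for every shift-invariant DLR state `μ` of `pinnedChain ω₂ lam β γ`
  (`ω₂, lam, β > 0`) at `T > 0`, the static sum `C₀ = ∑_x ∫ j_0 j_x dμ` is `> 0` (the landed
  `currentCorrelation_zero_pos` read through the landed Buttà–Marchioro dynamics);
* `map_momentumReversalZ_eq` — the crux's hypothesis `μ ∘ R⁻¹ = μ` is DERIVABLE from
  `IsChainGibbsMeasure T μ ∧ IsShiftInvariant μ` (uniqueness of the shift-invariant DLR state): it is idle;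
* `exists_pseudoDynamics` — for every such `μ` there is an inhabitant `D` of
  `InfiniteChainDynamics (pinnedChain …)` (empty carrier, `φ₀ = id`, `φ_t = R` for `t ≠ 0`) all of whose
  maps `φ_t` PRESERVE `μ` and commute with the shift EVERYWHERE, whose summed correlation
  `t ↦ D.currentCorrelation μ t` is NOT continuous at `0` (`C(0) = C₀ > 0`, `C(t) = -C₀` otherwise) and
  whose heat variance at `τ = 1` is `-C₀ < 0`: clauses (b) and (c) of the crux fail for it;
* `heatVarianceCalculus_false_without_carrierAE` — hence the crux with `D.PreservesMeasure μ` weakened to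
  its second clause `∀ t, MeasurePreserving (D.flow t) μ μ` is FALSE: any proof must use
  `∀ᵐ σ ∂μ, σ ∈ D.carrier` (the landed proof does, once, in the rigidity step `flow_ae_eq_canonical`);
  `heatVarianceCalculus_false_without_preservesMeasure` — a fortiori with the hypothesis dropped.

No new definitions. cdisprove seat refuter-cdisprove-stmt-AtomisticToContinuum-15772-0, 2026-08-17.
-/

noncomputable section

namespace Summit.AtomisticToContinuum.FouriersLaw.Theorems.HeatVarianceCalculus.Negative

open MeasureTheory Filter Topology Set
open Literature.MathematicalPhysics.KineticTheory.HeatConduction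
open Summit.AtomisticToContinuum.FouriersLaw.Theorems.GreenKuboContinuation.TemperatureBlindVitaliHurwitz

/-! ## §1 Static input: positivity of `C₀` and reversal symmetry of the state -/

/-- For `pinnedChain ω₂ lam β γ` (`ω₂, lam, β > 0`), `T > 0` and a shift-invariant DLR state `μ`:
`0 < C₀ = ∑_x ∫ j_0 j_x dμ`. Proof: `μ` is superstable
(`hasSuperstabilityEstimate_of_isShiftInvariant_pinnedChain`), the landed Buttà–Marchioro dynamics
`D♭` preserves it (`exists_bmDynamics_pinnedChain`), `0 < D♭.currentCorrelation μ 0`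
(`currentCorrelation_zero_pos`) and `D♭.currentCorrelation μ 0 = C₀` (`φ♭₀ = id` a.e.). [folklore] -/
theorem static_sum_pos {ω₂ lam β : ℝ} (γ : ℝ) (hω : 0 < ω₂) (hl : 0 < lam) (hβ : 0 < β) {T : ℝ}
    (hT : 0 < T) {μ : Measure ChainConfig} (hμ : (pinnedChain ω₂ lam β γ).IsChainGibbsMeasure T μ)
    (hS : IsShiftInvariant μ) :
    0 < ∑' x : ℤ, ∫ σ, (pinnedChain ω₂ lam β γ).bondCurrentZ σ 0 *
      (pinnedChain ω₂ lam β γ).bondCurrentZ σ x ∂μ := by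
  have hss := OscillatorChain.hasSuperstabilityEstimate_of_isShiftInvariant_pinnedChain γ hω hl.le
    hβ.le hT hμ hS
  obtain ⟨D, -, -, -, -, hpres⟩ := exists_bmDynamics_pinnedChain γ hω.le hl hβ
  have hD := hpres T μ hμ hss
  have hU : Continuous (pinnedChain ω₂ lam β γ).U := by
    show Continuous fun q : ℝ => ω₂ * q ^ 2 / 2 + lam * q ^ 4 / 4
    fun_prop
  have hpos := currentCorrelation_zero_pos one_le_two
    (OscillatorChain.pinnedChain_U_nonneg β γ hω.le hl.le) hU
    (OscillatorChain.pinnedChain_isEvenPolyOfDegree_V ω₂ lam γ hβ)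
    (pinnedChain_deriv_V_add_eq_zero γ hβ.le) D hT hμ hS hss hD
  have heq : D.currentCorrelation μ 0 = ∑' x : ℤ, ∫ σ, (pinnedChain ω₂ lam β γ).bondCurrentZ σ 0 *
      (pinnedChain ω₂ lam β γ).bondCurrentZ σ x ∂μ := by
    unfold InfiniteChainDynamics.currentCorrelation
    exact tsum_congr fun x => integral_congr_ae (D.bondCurrentZ_mul_flow_zero_ae_eq hD x)
  rwa [heq] at hpos

/-- **The reversal hypothesis of the crux is idle.** Every shift-invariant DLR state of the pinned chain
(`ω₂ > 0`, `lam, β ≥ 0`, `T > 0`) is momentum-reversal invariant: uniqueness of the shift-invariant DLR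
state (`eq_of_isChainGibbsMeasure_of_isShiftInvariant_pinnedChain`) and `R`-equivariance of the
specification (`map_momentumReversalZ_eq_of_regular_unique`). [folklore] -/
theorem map_momentumReversalZ_eq {ω₂ lam β : ℝ} (γ : ℝ) (hω : 0 < ω₂) (hl : 0 ≤ lam) (hβ : 0 ≤ β)
    {T : ℝ} (hT : 0 < T) {μ : Measure ChainConfig}
    (hμ : (pinnedChain ω₂ lam β γ).IsChainGibbsMeasure T μ) (hS : IsShiftInvariant μ) :
    μ.map momentumReversalZ = μ := by
  have hss := OscillatorChain.hasSuperstabilityEstimate_of_isShiftInvariant_pinnedChain γ hω hl hβ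
    hT hμ hS
  exact OscillatorChain.map_momentumReversalZ_eq_of_regular_unique hμ hS hss
    fun μ₁ μ₂ h₁ s₁ _ h₂ s₂ _ =>
      OscillatorChain.eq_of_isChainGibbsMeasure_of_isShiftInvariant_pinnedChain γ hω hl hβ hT h₁ s₁ h₂ s₂

/-! ## §2 The carrier-free pseudo-dynamics -/

/-- **A measure-preserving, shift-commuting inhabitant of `InfiniteChainDynamics` with a discontinuous
summed correlation and a negative heat variance.** For every shift-invariant DLR state `μ` of
`pinnedChain ω₂ lam β γ` (`ω₂, lam, β > 0`) at `T > 0` there is `D` with: every `φ_t` preserves `μ`;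
`φ_t ∘ shift = shift ∘ φ_t` everywhere; `C(0) = C₀`, `C(t) = -C₀` for `t ≠ 0` where
`C₀ = ∑_x ∫ j_0 j_x dμ > 0`; hence `t ↦ C(t)` is not continuous at `0` and
`V(1) = 2∫_{(0,1]} (1-s) C(s) ds = -C₀ < 0`. The inhabitant: `carrier = ∅` (so the fields `mapsTo`,
`flow_zero`, `isSolution`, `unique` hold vacuously), `φ₀ = id`, `φ_t = R` for `t ≠ 0` — it violates
exactly the clause `∀ᵐ σ ∂μ, σ ∈ D.carrier` of `PreservesMeasure`. [folklore] -/
theorem exists_pseudoDynamics {ω₂ lam β : ℝ} (γ : ℝ) (hω : 0 < ω₂) (hl : 0 < lam) (hβ : 0 < β)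
    {T : ℝ} (hT : 0 < T) {μ : Measure ChainConfig}
    (hμ : (pinnedChain ω₂ lam β γ).IsChainGibbsMeasure T μ) (hS : IsShiftInvariant μ) :
    ∃ D : InfiniteChainDynamics (pinnedChain ω₂ lam β γ),
      (∀ t : ℝ, MeasurePreserving (D.flow t) μ μ) ∧
      (∀ (t : ℝ) (σ : ChainConfig), D.flow t (shift σ) = shift (D.flow t σ)) ∧
      D.currentCorrelation μ 0 = ∑' x : ℤ, ∫ σ, (pinnedChain ω₂ lam β γ).bondCurrentZ σ 0 *
        (pinnedChain ω₂ lam β γ).bondCurrentZ σ x ∂μ ∧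
      (∀ t : ℝ, t ≠ 0 → D.currentCorrelation μ t =
        -∑' x : ℤ, ∫ σ, (pinnedChain ω₂ lam β γ).bondCurrentZ σ 0 *
          (pinnedChain ω₂ lam β γ).bondCurrentZ σ x ∂μ) ∧
      ¬ ContinuousAt (fun t : ℝ => D.currentCorrelation μ t) 0 ∧
      2 * ∫ s in Set.Ioc (0:ℝ) 1, (1 - s) * D.currentCorrelation μ s < 0 := by
  set P := pinnedChain ω₂ lam β γ with hP
  have hR : μ.map momentumReversalZ = μ := map_momentumReversalZ_eq γ hω hl.le hβ.le hT hμ hS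
  set C₀ := ∑' x : ℤ, ∫ σ, P.bondCurrentZ σ 0 * P.bondCurrentZ σ x ∂μ with hC₀
  have hpos : 0 < C₀ := static_sum_pos γ hω hl hβ hT hμ hS
  -- the pseudo-dynamics
  set D : InfiniteChainDynamics P :=
    { carrier := ∅
      flow := fun t σ => if t = 0 then σ else momentumReversalZ σ
      mapsTo := fun _ σ h => absurd h (Set.notMem_empty σ)
      flow_zero := fun σ h => absurd h (Set.notMem_empty σ)
      isSolution := fun σ h => absurd h (Set.notMem_empty σ)
      unique := fun _ hγ _ t => absurd (hγ t) (Set.notMem_empty _) } with hD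
  have hflow0 : D.flow 0 = id := by funext σ; simp [hD]
  have hflowt : ∀ t : ℝ, t ≠ 0 → D.flow t = momentumReversalZ := fun t ht => by
    funext σ; simp [hD, ht]
  have hC0 : D.currentCorrelation μ 0 = C₀ := by
    simp [InfiniteChainDynamics.currentCorrelation, hflow0, hC₀]
  have hCt : ∀ t : ℝ, t ≠ 0 → D.currentCorrelation μ t = -C₀ := fun t ht => by
    simp only [InfiniteChainDynamics.currentCorrelation, hflowt t ht, bondCurrentZ_momentumReversalZ,
      mul_neg, integral_neg, tsum_neg, hC₀]
  refine ⟨D, fun t => ?_, fun t σ => ?_, hC0, hCt, fun hcont => ?_, ?_⟩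
  · by_cases ht : t = 0
    · subst ht; rw [hflow0]; exact MeasurePreserving.id μ
    · rw [hflowt t ht]; exact ⟨momentumReversalZ.measurable, hR⟩
  · by_cases ht : t = 0
    · subst ht; simp [hflow0]
    · simp only [hflowt t ht]; exact (shift_momentumReversalZ σ).symm
  · -- `C(1/(n+1)) = -C₀ → C(0) = C₀` would force `C₀ = 0`
    have h1 : Tendsto (fun n : ℕ => D.currentCorrelation μ (1 / ((n : ℝ) + 1))) atTop
        (𝓝 (D.currentCorrelation μ 0)) :=
      hcont.tendsto.comp tendsto_one_div_add_atTop_nhds_zero_nat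
    have h2 : (fun n : ℕ => D.currentCorrelation μ (1 / ((n : ℝ) + 1))) = fun _ => -C₀ := by
      funext n
      exact hCt _ (by positivity)
    rw [h2, hC0] at h1
    have h3 : C₀ = -C₀ := tendsto_nhds_unique h1 tendsto_const_nhds
    linarith
  · have hcongr : ∫ s in Set.Ioc (0:ℝ) 1, (1 - s) * D.currentCorrelation μ s =
        ∫ s in Set.Ioc (0:ℝ) 1, (1 - s) * (-C₀) := by
      refine setIntegral_congr_fun measurableSet_Ioc fun s hs => ?_
      rw [hCt s hs.1.ne']
    have hval : ∫ s in Set.Ioc (0:ℝ) 1, (1 - s) * (-C₀) = -C₀ / 2 := by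
      rw [integral_mul_const, ← intervalIntegral.integral_of_le zero_le_one,
        intervalIntegral.integral_sub intervalIntegrable_const intervalIntegral.intervalIntegrable_id,
        intervalIntegral.integral_const, integral_id]
      ring
    rw [hcongr, hval]
    linarith

/-! ## §3 Load-bearing analysis of `D.PreservesMeasure μ` -/

/-- **The carrier clause `∀ᵐ σ ∂μ, σ ∈ D.carrier` is load-bearing.** `HeatVarianceCalculus` with
`D.PreservesMeasure μ` (= `(∀ᵐ σ ∂μ, σ ∈ D.carrier) ∧ ∀ t, MeasurePreserving (D.flow t) μ μ`)
WEAKENED to its second clause is false. Witness: `ω₂ = lam = β = T = 1`, `γ = 0`, the shift-invariant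
DLR state (`exists_isChainGibbsMeasure_shiftInvariant_superstable_pinnedChain`, `R`-invariant by
`map_momentumReversalZ_eq`) and the pseudo-dynamics of `exists_pseudoDynamics` (clause (b) fails).
[folklore] -/
theorem heatVarianceCalculus_false_without_carrierAE :
    ¬ ∀ ω₂ lam β γ : ℝ, 0 < ω₂ → 0 < lam → 0 < β → ∀ T : ℝ, 0 < T → ∀ μ : Measure ChainConfig,
      (pinnedChain ω₂ lam β γ).IsChainGibbsMeasure T μ → IsShiftInvariant μ →
      μ.map (fun σ : ChainConfig => fun x : ℤ => ((σ x).1, -(σ x).2)) = μ →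
      ∀ D : InfiniteChainDynamics (pinnedChain ω₂ lam β γ),
        (∀ t : ℝ, MeasurePreserving (D.flow t) μ μ) →
        (∀ t : ℝ, ∀ᵐ σ ∂μ, D.flow t (shift σ) = shift (D.flow t σ)) →
        (∀ t : ℝ, D.HasAbsConvergentCorrelation μ t) ∧
        Continuous (fun t : ℝ => D.currentCorrelation μ t) ∧
        ∀ V : ℝ → ℝ, V = (fun τ : ℝ => 2 * ∫ s in Set.Ioc (0:ℝ) τ, (τ - s) * D.currentCorrelation μ s) →
          (∀ τ : ℝ, 0 ≤ τ → 0 ≤ V τ) ∧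
          ∀ ν : ℝ, 0 < ν →
            IntegrableOn (fun t : ℝ => Real.exp (-(ν * t)) * D.currentCorrelation μ t) (Set.Ioi 0) ∧
            IntegrableOn (fun t : ℝ => Real.exp (-(ν * t)) * V t) (Set.Ioi 0) ∧
            ∫ t in Set.Ioi (0:ℝ), Real.exp (-(ν * t)) * D.currentCorrelation μ t =
              ν ^ 2 / 2 * ∫ t in Set.Ioi (0:ℝ), Real.exp (-(ν * t)) * V t := by
  intro h
  obtain ⟨μ, hμ, hS, -⟩ :=
    OscillatorChain.exists_isChainGibbsMeasure_shiftInvariant_superstable_pinnedChain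
      (ω₂ := 1) (lam := 1) (β := 1) (0 : ℝ) one_pos zero_le_one zero_le_one (T := 1) one_pos
  have hR : μ.map momentumReversalZ = μ :=
    map_momentumReversalZ_eq 0 one_pos zero_le_one zero_le_one one_pos hμ hS
  have hR' : μ.map (fun σ : ChainConfig => fun x : ℤ => ((σ x).1, -(σ x).2)) = μ := hR
  obtain ⟨D, hmp, hsh, -, -, hdis, -⟩ :=
    exists_pseudoDynamics (ω₂ := 1) (lam := 1) (β := 1) 0 one_pos one_pos one_pos one_pos hμ hS
  obtain ⟨-, hcont, -⟩ := h 1 1 1 0 one_pos one_pos one_pos 1 one_pos μ hμ hS hR' D hmp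
    (fun t => Eventually.of_forall (hsh t))
  exact hdis hcont.continuousAt

/-- **A fortiori: `D.PreservesMeasure μ` cannot be dropped.** [folklore] -/
theorem heatVarianceCalculus_false_without_preservesMeasure :
    ¬ ∀ ω₂ lam β γ : ℝ, 0 < ω₂ → 0 < lam → 0 < β → ∀ T : ℝ, 0 < T → ∀ μ : Measure ChainConfig,
      (pinnedChain ω₂ lam β γ).IsChainGibbsMeasure T μ → IsShiftInvariant μ →
      μ.map (fun σ : ChainConfig => fun x : ℤ => ((σ x).1, -(σ x).2)) = μ →
      ∀ D : InfiniteChainDynamics (pinnedChain ω₂ lam β γ),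
        (∀ t : ℝ, ∀ᵐ σ ∂μ, D.flow t (shift σ) = shift (D.flow t σ)) →
        (∀ t : ℝ, D.HasAbsConvergentCorrelation μ t) ∧
        Continuous (fun t : ℝ => D.currentCorrelation μ t) ∧
        ∀ V : ℝ → ℝ, V = (fun τ : ℝ => 2 * ∫ s in Set.Ioc (0:ℝ) τ, (τ - s) * D.currentCorrelation μ s) →
          (∀ τ : ℝ, 0 ≤ τ → 0 ≤ V τ) ∧
          ∀ ν : ℝ, 0 < ν →
            IntegrableOn (fun t : ℝ => Real.exp (-(ν * t)) * D.currentCorrelation μ t) (Set.Ioi 0) ∧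
            IntegrableOn (fun t : ℝ => Real.exp (-(ν * t)) * V t) (Set.Ioi 0) ∧
            ∫ t in Set.Ioi (0:ℝ), Real.exp (-(ν * t)) * D.currentCorrelation μ t =
              ν ^ 2 / 2 * ∫ t in Set.Ioi (0:ℝ), Real.exp (-(ν * t)) * V t :=
  fun h => heatVarianceCalculus_false_without_carrierAE
    fun ω₂ lam β γ hω hl hβ T hT μ hμ hS hR D _ hsh => h ω₂ lam β γ hω hl hβ T hT μ hμ hS hR D hsh

/-- **The pseudo-dynamics also violates clause (c)** of the crux (`V ≥ 0`): positivity of the heat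
variance is a property of a CARRIED flow (Koopman group, positive type of `C_T`), not of the static
Gibbs data — recorded as the `V`-form of `exists_pseudoDynamics`. [folklore] -/
theorem exists_pseudoDynamics_heatVariance_neg {ω₂ lam β : ℝ} (γ : ℝ) (hω : 0 < ω₂) (hl : 0 < lam)
    (hβ : 0 < β) {T : ℝ} (hT : 0 < T) {μ : Measure ChainConfig}
    (hμ : (pinnedChain ω₂ lam β γ).IsChainGibbsMeasure T μ) (hS : IsShiftInvariant μ) :
    ∃ D : InfiniteChainDynamics (pinnedChain ω₂ lam β γ),
      (∀ t : ℝ, MeasurePreserving (D.flow t) μ μ) ∧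
      (∀ (t : ℝ) (σ : ChainConfig), D.flow t (shift σ) = shift (D.flow t σ)) ∧
      ∀ V : ℝ → ℝ, V = (fun τ : ℝ => 2 * ∫ s in Set.Ioc (0:ℝ) τ, (τ - s) * D.currentCorrelation μ s) →
        V 1 < 0 := by
  obtain ⟨D, hmp, hsh, -, -, -, hneg⟩ := exists_pseudoDynamics γ hω hl hβ hT hμ hS
  exact ⟨D, hmp, hsh, fun V hV => by rw [hV]; exact hneg⟩

end Summit.AtomisticToContinuum.FouriersLaw.Theorems.HeatVarianceCalculus.Negative

end
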